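import Summits.KontsevichZagierPeriods.KontsevichZagierPeriods.Theorems.HurwitzMicroSectorsNormalFormPrincipleDilogExistsBoxAtoms
import Literature.NumberTheory.Transcendental.MZVSimplexRep

/-!
# `NormalFormPrinciple` (stmt-KontsevichZagierPeriods-3869), line `SketchIdeator1` —
# leaf `stub_boxRigidity`, layer `M3` (EulerBoxDuality): the three simplex representations exist

Pure proof file (stub `ebd_exists_simplexReps` of the layer `M3`, lead seat c9; `--supports` the
crux). In the move chain for Euler's `ζ(2,1) = ζ(3)` in box form,
`[(0,1)³, 1/((1−xy)(1−xyz))] ∼ [(0,1)³, 2/(1−xyz)]`, the simplex chart `(x₀, x₀x₁, x₀x₁x₂)`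
carries the open unit box onto the decreasing open simplex
`Δ = {t | 0 < t₂ < t₁ < t₀ < 1} ⊆ ℝ³`, where the integrand becomes
`F = 1/(t₀ t₁ (1−t₁)(1−t₂)) = G + H` with `G = 1/(t₀ t₁ (1−t₂))` (Kontsevich's iterated integral
`ω₀ω₀ω₁` of `ζ(3)`) and `H = 1/(t₀ (1−t₁)(1−t₂))` (`ω₀ω₁ω₁`, i.e. `ζ(2,1)`).

This file supplies the EXISTENCE of the three carriers `[Δ, F]`, `[Δ, G]`, `[Δ, H]` as honest
integral representations of the Kontsevich–Zagier calculus
(`Literature.NumberTheory.Transcendental.KZ.IntegralRep 3`), with literally these domains and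
integrands: `Δ` is the library's open ordered simplex `KZ.openOrderedSimplex 3` (hence
`ℚ`-semialgebraic and measurable); each integrand is the reciprocal of a `ℚ`-polynomial that does
not vanish on `Δ` (hence a `ℚ`-semialgebraic function there, `isSemialgebraicFunOn_aeval_div_aeval`);
and `G`, `H` are the integrands `KZ.mzvIntegrand [3]`, `KZ.mzvIntegrand [2, 1]` of Kontsevich's
formula, which converge absolutely on the open simplex by the library's domination lemma
(`KZ.mzvIntegrand_integrableOn_holds`), so that `F = G + H` (partial fractions in `t₁`) converges
absolutely as well. No move of the calculus is performed here, and the representation of the box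
side offered by the registered signature is not needed for the construction.

References: M. Kontsevich, D. Zagier, *Periods* (2001), §1.1–1.2; D. Zagier, *Values of zeta
functions and their applications* (1994), §9. No definitions are introduced.
-/

noncomputable section

open MeasureTheory Set
open Literature.NumberTheory.Transcendental Literature.NumberTheory.Transcendental.KZ
open Literature.ModelTheory.ExponentialFields (IsSemialgebraic)

namespace Summit.KontsevichZagierPeriods.HurwitzMicroSectors.NormalFormPrinciple.PiBox.M3

/-! ## The decreasing open simplex `Δ = {0 < t₂ < t₁ < t₀ < 1}` -/

/-- The decreasing open simplex `{t | 0 < t₂ < t₁ < t₀ < 1}` of `ℝ³` is the library's open ordered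
simplex `KZ.openOrderedSimplex 3 = {t | 1 > t₀ > t₁ > t₂ > 0}`. [folklore] -/
theorem ebd2_simplex_eq_openOrderedSimplex :
    {t : Fin 3 → ℝ | 0 < t 2 ∧ t 2 < t 1 ∧ t 1 < t 0 ∧ t 0 < 1} = openOrderedSimplex 3 := by
  -- adapted from Cruxes/WheelThreeSpokes/Disproof.lean `simplex3_eq_openOrderedSimplex`
  ext t
  simp only [openOrderedSimplex, mem_setOf_eq]
  constructor
  · rintro ⟨h2, h21, h10, h0⟩
    refine ⟨?_, ?_, ?_⟩
    · intro i
      fin_cases i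
      exacts [(h2.trans h21).trans h10, h2.trans h21, h2]
    · intro i
      fin_cases i
      exacts [h0, h10.trans h0, (h21.trans h10).trans h0]
    · rw [Fin.strictAnti_iff_succ_lt]
      intro i
      fin_cases i
      exacts [h10, h21]
  · rintro ⟨hpos, hlt, hanti⟩
    exact ⟨hpos 2, hanti (by decide : (1 : Fin 3) < 2), hanti (by decide : (0 : Fin 3) < 1), hlt 0⟩

/-- The decreasing open simplex of `ℝ³` is `ℚ`-semialgebraic (strict `ℚ`-polynomial
inequalities; `KZ.isSemialgebraic_openOrderedSimplex`). [cite: KontsevichZagier2001, §1.1] -/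
theorem ebd2_isSemialgebraic_simplex :
    IsSemialgebraic ℚ {t : Fin 3 → ℝ | 0 < t 2 ∧ t 2 < t 1 ∧ t 1 < t 0 ∧ t 0 < 1} := by
  rw [ebd2_simplex_eq_openOrderedSimplex]
  exact isSemialgebraic_openOrderedSimplex 3

/-- The decreasing open simplex of `ℝ³` is Lebesgue measurable. [folklore] -/
theorem ebd2_measurableSet_simplex :
    MeasurableSet {t : Fin 3 → ℝ | 0 < t 2 ∧ t 2 < t 1 ∧ t 1 < t 0 ∧ t 0 < 1} := by
  rw [ebd2_simplex_eq_openOrderedSimplex]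
  exact measurableSet_openOrderedSimplex 3

/-- On the decreasing open simplex the four linear forms `t₀`, `t₁`, `1 − t₁`, `1 − t₂` are
positive. [folklore] -/
theorem ebd2_pos_of_mem_simplex {t : Fin 3 → ℝ}
    (ht : t ∈ {t : Fin 3 → ℝ | 0 < t 2 ∧ t 2 < t 1 ∧ t 1 < t 0 ∧ t 0 < 1}) :
    0 < t 0 ∧ 0 < t 1 ∧ 0 < 1 - t 1 ∧ 0 < 1 - t 2 := by
  obtain ⟨h2, h21, h10, h0⟩ := ht
  exact ⟨by linarith, by linarith, by linarith, by linarith⟩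

/-! ## Semialgebraicity of the three integrands -/

/-- `F = 1/(t₀ t₁ (1−t₁)(1−t₂))` is a `ℚ`-semialgebraic function on the decreasing open simplex:
the reciprocal of a `ℚ`-polynomial which does not vanish there. [cite: KontsevichZagier2001, §1.1] -/
theorem ebd2_isSemialgebraicFunOn_F :
    IsSemialgebraicFunOn ℚ {t : Fin 3 → ℝ | 0 < t 2 ∧ t 2 < t 1 ∧ t 1 < t 0 ∧ t 0 < 1}
      (fun t => 1 / (t 0 * t 1 * (1 - t 1) * (1 - t 2))) := by
  refine (isSemialgebraicFunOn_aeval_div_aeval ebd2_isSemialgebraic_simplex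
    (1 : MvPolynomial (Fin 3) ℚ)
    (MvPolynomial.X 0 * MvPolynomial.X 1 * (1 - MvPolynomial.X 1) * (1 - MvPolynomial.X 2))
    fun t ht => ?_).congr fun t _ => ?_
  · obtain ⟨h0, h1, h1', h2'⟩ := ebd2_pos_of_mem_simplex ht
    simp only [map_mul, map_sub, map_one, MvPolynomial.aeval_X]
    positivity
  · simp only [map_mul, map_sub, map_one, MvPolynomial.aeval_X]

/-- `G = 1/(t₀ t₁ (1−t₂))` is a `ℚ`-semialgebraic function on the decreasing open simplex.
[cite: KontsevichZagier2001, §1.1] -/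
theorem ebd2_isSemialgebraicFunOn_G :
    IsSemialgebraicFunOn ℚ {t : Fin 3 → ℝ | 0 < t 2 ∧ t 2 < t 1 ∧ t 1 < t 0 ∧ t 0 < 1}
      (fun t => 1 / (t 0 * t 1 * (1 - t 2))) := by
  refine (isSemialgebraicFunOn_aeval_div_aeval ebd2_isSemialgebraic_simplex
    (1 : MvPolynomial (Fin 3) ℚ)
    (MvPolynomial.X 0 * MvPolynomial.X 1 * (1 - MvPolynomial.X 2))
    fun t ht => ?_).congr fun t _ => ?_
  · obtain ⟨h0, h1, h1', h2'⟩ := ebd2_pos_of_mem_simplex ht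
    simp only [map_mul, map_sub, map_one, MvPolynomial.aeval_X]
    positivity
  · simp only [map_mul, map_sub, map_one, MvPolynomial.aeval_X]

/-- `H = 1/(t₀ (1−t₁)(1−t₂))` is a `ℚ`-semialgebraic function on the decreasing open simplex.
[cite: KontsevichZagier2001, §1.1] -/
theorem ebd2_isSemialgebraicFunOn_H :
    IsSemialgebraicFunOn ℚ {t : Fin 3 → ℝ | 0 < t 2 ∧ t 2 < t 1 ∧ t 1 < t 0 ∧ t 0 < 1}
      (fun t => 1 / (t 0 * (1 - t 1) * (1 - t 2))) := by
  refine (isSemialgebraicFunOn_aeval_div_aeval ebd2_isSemialgebraic_simplex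
    (1 : MvPolynomial (Fin 3) ℚ)
    (MvPolynomial.X 0 * (1 - MvPolynomial.X 1) * (1 - MvPolynomial.X 2))
    fun t ht => ?_).congr fun t _ => ?_
  · obtain ⟨h0, h1, h1', h2'⟩ := ebd2_pos_of_mem_simplex ht
    simp only [map_mul, map_sub, map_one, MvPolynomial.aeval_X]
    positivity
  · simp only [map_mul, map_sub, map_one, MvPolynomial.aeval_X]

/-! ## Absolute convergence: Kontsevich's iterated integrals of `ζ(3)` and `ζ(2,1)` -/

/-- The integrand of Kontsevich's formula for `ζ(3)` (word `001`) is
`ω₀(t₀)ω₀(t₁)ω₁(t₂) = (1/t₀)(1/t₁)(1/(1−t₂))`. [cite: Zagier1994, §9] -/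
theorem ebd2_mzvIntegrand_three (t : Fin 3 → ℝ) :
    mzvIntegrand [3] t = 1 / t 0 * (1 / t 1) * (1 / (1 - t 2)) := by
  -- adapted from Cruxes/PentagonInKZ/Disproof.lean `mzvIntegrand_three_eq`
  have hw : MZV.binaryWord [3] = [false, false, true] := by decide
  unfold mzvIntegrand
  rw [hw]
  show (∏ i : Fin 3, mzvForm ([false, false, true].getD i false) (t i)) = _
  rw [Fin.prod_univ_three]
  simp [mzvForm]

/-- The integrand of Kontsevich's formula for `ζ(2,1)` (word `011`) is
`ω₀(t₀)ω₁(t₁)ω₁(t₂) = (1/t₀)(1/(1−t₁))(1/(1−t₂))`. [cite: Zagier1994, §9] -/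
theorem ebd2_mzvIntegrand_twoOne (t : Fin 3 → ℝ) :
    mzvIntegrand [2, 1] t = 1 / t 0 * (1 / (1 - t 1)) * (1 / (1 - t 2)) := by
  -- adapted from Cruxes/PentagonInKZ/Disproof.lean `mzvIntegrand_three_eq`
  have hw : MZV.binaryWord [2, 1] = [false, true, true] := by decide
  unfold mzvIntegrand
  rw [hw]
  show (∏ i : Fin 3, mzvForm ([false, true, true].getD i false) (t i)) = _
  rw [Fin.prod_univ_three]
  simp [mzvForm]

/-- **Absolute convergence of `G = 1/(t₀ t₁ (1−t₂))` on the decreasing open simplex**: it is the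
integrand of Kontsevich's iterated integral for `ζ(3)`, which converges absolutely on the open
ordered simplex (`KZ.mzvIntegrand_integrableOn_holds`). [cite: Zagier1994, §9] -/
theorem ebd2_integrableOn_G :
    IntegrableOn (fun t : Fin 3 → ℝ => 1 / (t 0 * t 1 * (1 - t 2)))
      {t : Fin 3 → ℝ | 0 < t 2 ∧ t 2 < t 1 ∧ t 1 < t 0 ∧ t 0 < 1} := by
  have h : IntegrableOn (mzvIntegrand [3]) (openOrderedSimplex 3) volume :=
    mzvIntegrand_integrableOn_holds [3] (by decide)
  rw [ebd2_simplex_eq_openOrderedSimplex]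
  refine h.congr_fun (fun t _ => ?_) (measurableSet_openOrderedSimplex 3)
  rw [ebd2_mzvIntegrand_three, one_div_mul_one_div, one_div_mul_one_div]

/-- **Absolute convergence of `H = 1/(t₀ (1−t₁)(1−t₂))` on the decreasing open simplex**: it is
the integrand of Kontsevich's iterated integral for `ζ(2,1)`, which converges absolutely on the
open ordered simplex (`KZ.mzvIntegrand_integrableOn_holds`). [cite: Zagier1994, §9] -/
theorem ebd2_integrableOn_H :
    IntegrableOn (fun t : Fin 3 → ℝ => 1 / (t 0 * (1 - t 1) * (1 - t 2)))
      {t : Fin 3 → ℝ | 0 < t 2 ∧ t 2 < t 1 ∧ t 1 < t 0 ∧ t 0 < 1} := by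
  have h : IntegrableOn (mzvIntegrand [2, 1]) (openOrderedSimplex 3) volume :=
    mzvIntegrand_integrableOn_holds [2, 1] (by decide)
  rw [ebd2_simplex_eq_openOrderedSimplex]
  refine h.congr_fun (fun t _ => ?_) (measurableSet_openOrderedSimplex 3)
  rw [ebd2_mzvIntegrand_twoOne, one_div_mul_one_div, one_div_mul_one_div]

/-- **Absolute convergence of `F = 1/(t₀ t₁ (1−t₁)(1−t₂))` on the decreasing open simplex**: by
partial fractions in `t₁`, `F = G + H` there (`1/(t₁(1−t₁)) = 1/t₁ + 1/(1−t₁)`), a sum of two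
absolutely convergent integrands. [cite: KontsevichZagier2001, §1.1] -/
theorem ebd2_integrableOn_F :
    IntegrableOn (fun t : Fin 3 → ℝ => 1 / (t 0 * t 1 * (1 - t 1) * (1 - t 2)))
      {t : Fin 3 → ℝ | 0 < t 2 ∧ t 2 < t 1 ∧ t 1 < t 0 ∧ t 0 < 1} := by
  have hsum : IntegrableOn
      (fun t : Fin 3 → ℝ => 1 / (t 0 * t 1 * (1 - t 2)) + 1 / (t 0 * (1 - t 1) * (1 - t 2)))
      {t : Fin 3 → ℝ | 0 < t 2 ∧ t 2 < t 1 ∧ t 1 < t 0 ∧ t 0 < 1} :=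
    ebd2_integrableOn_G.add ebd2_integrableOn_H
  refine hsum.congr_fun (fun t ht => ?_) ebd2_measurableSet_simplex
  obtain ⟨h0, h1, h1', h2'⟩ := ebd2_pos_of_mem_simplex ht
  have hA : t 0 * t 1 * (1 - t 2) ≠ 0 := by positivity
  have hB : t 0 * (1 - t 1) * (1 - t 2) ≠ 0 := by positivity
  have hC : t 0 * t 1 * (1 - t 1) * (1 - t 2) ≠ 0 := by positivity
  show 1 / (t 0 * t 1 * (1 - t 2)) + 1 / (t 0 * (1 - t 1) * (1 - t 2)) =
    1 / (t 0 * t 1 * (1 - t 1) * (1 - t 2))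
  rw [one_div_add_one_div hA hB, div_eq_div_iff (mul_ne_zero hA hB) hC]
  ring

/-! ## Existence of the three simplex representations -/

/-- **`[Δ, F]` exists**: the decreasing open simplex with the integrand
`1/(t₀ t₁ (1−t₁)(1−t₂))` (the image of `[(0,1)³, 1/((1−xy)(1−xyz))]` under the simplex chart) is
an integral representation of the Kontsevich–Zagier calculus. [cite: KontsevichZagier2001, §1.1] -/
theorem ebd2_exists_TF :
    ∃ TF : IntegralRep 3, TF.domain = {t | 0 < t 2 ∧ t 2 < t 1 ∧ t 1 < t 0 ∧ t 0 < 1} ∧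
      TF.integrand = fun t => 1 / (t 0 * t 1 * (1 - t 1) * (1 - t 2)) :=
  ⟨⟨_, _, ebd2_isSemialgebraic_simplex, ebd2_isSemialgebraicFunOn_F, ebd2_integrableOn_F⟩,
    rfl, rfl⟩

/-- **`[Δ, G]` exists**: the decreasing open simplex with the integrand `1/(t₀ t₁ (1−t₂))`
(Kontsevich's `ζ(3)`) is an integral representation of the Kontsevich–Zagier calculus.
[cite: KontsevichZagier2001, §1.1] -/
theorem ebd2_exists_TG :
    ∃ TG : IntegralRep 3, TG.domain = {t | 0 < t 2 ∧ t 2 < t 1 ∧ t 1 < t 0 ∧ t 0 < 1} ∧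
      TG.integrand = fun t => 1 / (t 0 * t 1 * (1 - t 2)) :=
  ⟨⟨_, _, ebd2_isSemialgebraic_simplex, ebd2_isSemialgebraicFunOn_G, ebd2_integrableOn_G⟩,
    rfl, rfl⟩

/-- **`[Δ, H]` exists**: the decreasing open simplex with the integrand `1/(t₀ (1−t₁)(1−t₂))`
(Kontsevich's `ζ(2,1)`) is an integral representation of the Kontsevich–Zagier calculus.
[cite: KontsevichZagier2001, §1.1] -/
theorem ebd2_exists_TH :
    ∃ TH : IntegralRep 3, TH.domain = {t | 0 < t 2 ∧ t 2 < t 1 ∧ t 1 < t 0 ∧ t 0 < 1} ∧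
      TH.integrand = fun t => 1 / (t 0 * (1 - t 1) * (1 - t 2)) :=
  ⟨⟨_, _, ebd2_isSemialgebraic_simplex, ebd2_isSemialgebraicFunOn_H, ebd2_integrableOn_H⟩,
    rfl, rfl⟩

/-! ## The registered sub-goal -/

/-- **Stub E2 (existence of the three simplex representations of EulerBoxDuality; registered
sub-goal `ebd_exists_simplexReps` of stmt-KontsevichZagierPeriods-3869, line `SketchIdeator1`,
layer `M3`).** Given any representation `r` of `[(0,1)³, 1/((1−xy)(1−xyz))]`, the three carriers
`[Δ, 1/(t₀ t₁ (1−t₁)(1−t₂))]`, `[Δ, 1/(t₀ t₁ (1−t₂))]`, `[Δ, 1/(t₀ (1−t₁)(1−t₂))]` on the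
decreasing open simplex `Δ = {0 < t₂ < t₁ < t₀ < 1}` exist as integral representations of the
Kontsevich–Zagier calculus with literally these domains and integrands. (The representation `r`,
offered as an analytic input — integrability could be transported from it along the simplex chart
`(x₀, x₀x₁, x₀x₁x₂)` — is not needed: absolute convergence on `Δ` is the library's domination lemma
for Kontsevich's iterated integrals of `ζ(3)` and `ζ(2,1)`.) [cite: KontsevichZagier2001, §1.1] -/
theorem ebd_exists_simplexReps :
    ∀ (r : IntegralRep 3), r.domain = {x | ∀ i, x i ∈ Set.Ioo (0:ℝ) 1} →
      EqOn r.integrand (fun x => 1 / ((1 - x 0 * x 1) * (1 - x 0 * x 1 * x 2))) r.domain →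
      (∃ TF : IntegralRep 3, TF.domain = {t | 0 < t 2 ∧ t 2 < t 1 ∧ t 1 < t 0 ∧ t 0 < 1} ∧
        TF.integrand = fun t => 1 / (t 0 * t 1 * (1 - t 1) * (1 - t 2))) ∧
      (∃ TG : IntegralRep 3, TG.domain = {t | 0 < t 2 ∧ t 2 < t 1 ∧ t 1 < t 0 ∧ t 0 < 1} ∧
        TG.integrand = fun t => 1 / (t 0 * t 1 * (1 - t 2))) ∧
      (∃ TH : IntegralRep 3, TH.domain = {t | 0 < t 2 ∧ t 2 < t 1 ∧ t 1 < t 0 ∧ t 0 < 1} ∧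
        TH.integrand = fun t => 1 / (t 0 * (1 - t 1) * (1 - t 2))) :=
  fun _ _ _ => ⟨ebd2_exists_TF, ebd2_exists_TG, ebd2_exists_TH⟩

end Summit.KontsevichZagierPeriods.HurwitzMicroSectors.NormalFormPrinciple.PiBox.M3
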